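import Literature.NumberTheory.Sieve.FriedlanderIwaniecPrimesProp21Lemmas
import Literature.NumberTheory.Sieve.AsymptoticSieveForPrimesTheorem2Inputs
import Literature.NumberTheory.Sieve.AsymptoticSieveForPrimesRoughWeakAssembly
import HarnessLib

/-!
# Friedlander–Iwaniec, Proposition 2.1 in consumed form, DISCHARGED (ASP Theorems 2–3, §9–§10)

Trunk T-SIEVE, family `parity`; second companion ("Proofs") file of
`Literature.NumberTheory.Sieve.FriedlanderIwaniecPrimesProp21`. Sources: J. Friedlander, H. Iwaniec,
*The polynomial `X² + Y⁴` captures its primes*, Ann. of Math. (2) 148 (1998), 945–1040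
[FriedlanderIwaniecAnnals1998], §2 Proposition 2.1, (2.1)–(2.17); J. Friedlander, H. Iwaniec,
*Asymptotic sieve for primes*, ibid. 1041–1065 [FriedlanderIwaniecASP1998] (= arXiv:math/9811186),
§9 Theorem 2 (pp. 1058–1063: (9.4) `ã_n = μ²(n) a_n`, (9.5) `g̃`, (9.7) = (R) for `ã`, (9.8) `G`,
(9.12) `Ã(x) = G A(x)(1 + O(1/log x))`, (9.13)–(9.14) `H̃ = H/G`) and §10 Theorem 3 ((B*)).

* **`FriedlanderIwaniec1998_prop21_consumed_holds`** — the named fact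
  `Literature.NumberTheory.Sieve.FriedlanderIwaniec1998_prop21_consumed` (FI Proposition 2.1 with
  hypothesis (2.8) in the form its proof consumes: (2.8) for cubefree moduli and the divisor cube
  moment (2.8′)) is a THEOREM. Proof = FI's proof of Theorem 2 (§9) on top of the tree's Theorem 1
  under (B*) (§10): the squarefree-supported sequence `ã = μ²a` (`SieveSequence.moebiusSq`,
  `…Theorem2Density`) satisfies the core hypotheses of Theorem 1 — `size_eq`; (1.4) from (2.1) and
  `Ã(x) ≥ (G/2) A(x)`; (1.6) from the cubefree (2.8) (`Ã_d ≤ A_d`, `Ã_d = 0` off squarefree `d`);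
  (1.8), (1.9) for `g̃` (`moebiusSq_hyp18`, `moebiusSq_hyp19`, `…Theorem2Inputs`); (1.16); (R1); and
  (R) = (9.7) from `ASPTheorem2.sqfree_sieve_main_estimates` (`…Prop21Lemmas`: the error terms
  `E₀, E₁, E₂₁, E₂₂` of pp. 1061–1062 with (R′₃), the divisor cube moment in place of Lemma 2, (9.2)
  and Rankin's trick, saving `(log x)^{-2^{22}-1}`, the spare `log x` clearing the constant and the
  factor `A(x)/Ã(x) ≤ 2/G`); the parameter clause (10.2) = (2.15); the sieved bilinear bound in the
  printed-saving form (B*₂₂) from (2.11) (`moebiusSq_fiBilinearRough_le_fiBilinearPi`: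
  `B*(ã) ≤ B_Π(a) ≤ A(x)(log x)^{-2^{26}} ≤ Ã(x)(log x)^{-2^{22}}`, again `A ≤ (2/G)Ã` and four spare
  powers of `log x`); and `H̃ = H/G` (`hasDensityConstant_moebiusSq`). Theorem 1 under (B*₂₂)
  (`fi_asymptotic_sieve_primes_roughWeak_loglog`, `…RoughWeakAssembly`) gives
  `S(x) - H̃ Ã(x) = O(H̃ Ã(x) log log x/log x)`, and (9.12) (`sqfree_sieve_main_estimates`, second
  clause, `G` identified with `sqConst g` by uniqueness of limits) converts `H̃ Ã(x)` into `H A(x)`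
  ((9.14)).

## References

* J. Friedlander, H. Iwaniec, *The polynomial `X² + Y⁴` captures its primes*, Ann. of Math. 148
  (1998), 945–1040, Proposition 2.1. [cite: FriedlanderIwaniecAnnals1998, Proposition 2.1]
* J. Friedlander, H. Iwaniec, *Asymptotic sieve for primes*, Ann. of Math. 148 (1998), 1041–1065,
  §9 Theorem 2, §10 Theorem 3. [cite: FriedlanderIwaniecASP1998, §9 Theorem 2 and §10 Theorem 3]

## Mathlib / tree search

Tree (reused): `SieveSequence.moebiusSq`, `moebiusSqDensity`, `sqProd`, `sqConst`, `tendsto_sqProd`,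
`sqConst_pos`, `hasDensityConstant_moebiusSq`, `moebiusSq_primeSum`, `moebiusSq_size_nonneg_le`,
`moebiusSq_congrSum_le`, `moebiusSq_congrSum_eq_zero`, `moebiusSq_a_of_not_squarefree`
(`…Theorem2Density`); `moebiusSq_hyp18`, `moebiusSq_hyp19`, `moebiusSq_fiBilinearRough_le_fiBilinearPi`
(`…Theorem2Inputs`); `fi_asymptotic_sieve_primes_roughWeak_loglog` (`…RoughWeakAssembly`);
`ASPTheorem2.sqfree_sieve_main_estimates` (`…Prop21Lemmas`); `FIAsymptoticSieveHypothesesCore`,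
`fiLogSaving` (`…Rough`, `…AsymptoticSieveForPrimes`). Mathlib: `tendsto_nhds_unique`,
`Asymptotics.IsBigO.of_bound`, `IsBigO.trans`, `IsBigO.add`.
`lean search 'prop21_consumed_holds'`: nothing before this file.
-/

noncomputable section

open Filter Finset Real Asymptotics
open scoped Topology ArithmeticFunction.Moebius ArithmeticFunction.sigma

namespace Literature.NumberTheory.Sieve

/-- **FI Proposition 2.1 in consumed form (= ASP Theorems 2–3 with (1.6) for cubefree moduli and
the divisor cube moment), DISCHARGED.** See the module docstring for the architecture (FI §9 on top
of the tree's Theorem 1 under (B*)).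
[cite: FriedlanderIwaniecAnnals1998, Proposition 2.1; FriedlanderIwaniecASP1998, §9 Theorem 2, §10 Theorem 3] -/
theorem FriedlanderIwaniec1998_prop21_consumed_holds : FriedlanderIwaniec1998_prop21_consumed := by
  intro A D P α θ H hα hθ hθ3 hhyp hmom hH
  classical
  obtain ⟨hsize, h21, h22, h24, h2526, h27, h28, hpar, h29, h211⟩ := hhyp
  obtain ⟨K, hK⟩ := h2526
  have hg : A.density.IsMultiplicative := A.density_mult
  -- ### §9: the main estimates (9.7)⁺ and (9.12) for `ã = μ² a`
  obtain ⟨G, C, hG0, hGt, hmain⟩ := ASPTheorem2.sqfree_sieve_main_estimates A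
    (g' := moebiusSqDensity A.density) (isMultiplicative_moebiusSqDensity A.density) hsize h22 h24
    ⟨K, hK⟩ h27 (hpar.mono fun x hx => ⟨hx.1, hx.2.1⟩) h29 hmom
    (fun p hp => moebiusSqDensity_prime A.density hp)
  -- `G = sqConst g` (both are the limit of `∏_{p ≤ y} (1 - g(p²))`)
  have hGeq : G = sqConst A.density := tendsto_nhds_unique hGt (tendsto_sqProd h24)
  have hGne : G ≠ 0 := hG0.ne'
  set At := A.moebiusSq with hAt
  -- unfolding the size, the congruence sums and the remainders of `ã`
  have hAt_size : ∀ t : ℝ, At.size t = ∑ n ∈ (Ioc 0 ⌊t⌋₊).filter (1 ∣ ·), (if Squarefree n then A.a n else 0) :=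
    fun t => rfl
  have hAt_congr : ∀ (d : ℕ) (t : ℝ), At.congrSum d t =
      ∑ n ∈ (Ioc 0 ⌊t⌋₊).filter (d ∣ ·), (if Squarefree n then A.a n else 0) := fun d t => rfl
  have hAt_rem : ∀ (d : ℕ) (t : ℝ), At.remainder d t =
      (∑ n ∈ (Ioc 0 ⌊t⌋₊).filter (d ∣ ·), (if Squarefree n then A.a n else 0)) -
        moebiusSqDensity A.density d *
          ∑ n ∈ (Ioc 0 ⌊t⌋₊).filter (1 ∣ ·), (if Squarefree n then A.a n else 0) := fun d t => rfl
  have hAt_le : ∀ t : ℝ, 0 ≤ At.size t ∧ At.size t ≤ A.size t := fun t => by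
    have h := A.moebiusSq_size_nonneg_le t
    rw [← hsize] at h
    exact h
  have hA_nonneg : ∀ t : ℝ, 0 ≤ A.size t := fun t => (hAt_le t).1.trans (hAt_le t).2
  -- `log x → ∞`, `log log x ≥ 1`
  have hlog := Real.tendsto_log_atTop
  -- ### (9.12): `Ã(x) ≥ (G/2) A(x)`, `|Ã(x) - G A(x)| ≤ C A(x)/log x`, `C A(x)/log x ≤ (G/2) A(x)`
  have hlow : ∀ᶠ x : ℝ in atTop, G / 2 * A.size x ≤ At.size x ∧
      |At.size x - G * A.size x| ≤ C * A.size x / Real.log x ∧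
      C * A.size x / Real.log x ≤ G / 2 * A.size x := by
    filter_upwards [hmain, hlog.eventually_ge_atTop (max (2 * C / G) 1)] with x hx hlx
    have hl1 : 1 ≤ Real.log x := le_trans (le_max_right _ _) hlx
    have hl0 : 0 < Real.log x := by linarith
    have h2 := hx.2
    rw [← hAt_size] at h2
    have hA0 := hA_nonneg x
    have hCle : C * A.size x / Real.log x ≤ G / 2 * A.size x := by
      rcases le_or_gt C 0 with hC | hC
      · exact le_trans (div_nonpos_of_nonpos_of_nonneg (mul_nonpos_of_nonpos_of_nonneg hC hA0) hl0.le)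
          (by positivity)
      · rw [div_le_iff₀ hl0]
        have : 2 * C / G ≤ Real.log x := le_trans (le_max_left _ _) hlx
        rw [div_le_iff₀ hG0] at this
        nlinarith
    refine ⟨?_, h2, hCle⟩
    have := (abs_le.mp h2).1
    linarith
  -- ### the core hypotheses of Theorem 1 for `ã`
  have hcore : At.FIAsymptoticSieveHypothesesCore D := by
    refine ⟨A.moebiusSq_size_eq, ?_, ?_, ?_, ?_, fun n hn => A.moebiusSq_a_of_not_squarefree hn,
      hpar.mono fun x hx => ⟨hx.1, hx.2.1⟩, ?_⟩
    · -- (1.4) from (2.1)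
      obtain ⟨c, hc, h21'⟩ := h21
      refine ⟨c * (G / 2), by positivity, ?_⟩
      filter_upwards [h21', hlow] with x hx hlx
      have h1 := (hAt_le (Real.sqrt x)).2
      have hl2 : 0 ≤ Real.log x ^ 2 := sq_nonneg _
      calc c * (G / 2) * At.size (Real.sqrt x) * Real.log x ^ 2
          = G / 2 * (c * At.size (Real.sqrt x) * Real.log x ^ 2) := by ring
        _ ≤ G / 2 * (c * A.size (Real.sqrt x) * Real.log x ^ 2) := by
            refine mul_le_mul_of_nonneg_left ?_ (by positivity)
            exact mul_le_mul_of_nonneg_right (mul_le_mul_of_nonneg_left h1 hc.le) hl2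
        _ ≤ G / 2 * A.size x := mul_le_mul_of_nonneg_left hx (by positivity)
        _ ≤ At.size x := hlx.1
    · -- (1.6) from the cubefree (2.8)
      obtain ⟨K₈, h28'⟩ := h28
      refine ⟨max K₈ 0 * (2 / G), ?_⟩
      filter_upwards [h28', hlow] with x hx hlx d hd hdx
      have hA0 := hA_nonneg x
      have hAG : A.size x ≤ 2 / G * At.size x := by
        rw [div_mul_eq_mul_div, le_div_iff₀ hG0]; linarith [hlx.1]
      by_cases hdsq : Squarefree d
      · calc At.congrSum d x ≤ A.congrSum d x := A.moebiusSq_congrSum_le d x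
          _ ≤ K₈ * (ArithmeticFunction.sigma 0 d : ℝ) ^ 8 / d * A.size x :=
              hx d hd (IsCubefree.of_squarefree hdsq) hdx
          _ ≤ max K₈ 0 * (ArithmeticFunction.sigma 0 d : ℝ) ^ 8 / d * A.size x := by
              refine mul_le_mul_of_nonneg_right ?_ hA0
              exact div_le_div_of_nonneg_right (mul_le_mul_of_nonneg_right (le_max_left _ _)
                (by positivity)) (Nat.cast_nonneg _)
          _ ≤ max K₈ 0 * (ArithmeticFunction.sigma 0 d : ℝ) ^ 8 / d * (2 / G * At.size x) :=
              mul_le_mul_of_nonneg_left hAG (by positivity)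
          _ = max K₈ 0 * (2 / G) * (ArithmeticFunction.sigma 0 d : ℝ) ^ 8 / d * At.size x := by ring
      · rw [A.moebiusSq_congrSum_eq_zero hdsq]
        have := (hAt_le x).1
        positivity
    · -- (1.8) for `g̃`
      exact ⟨K, A.moebiusSq_hyp18 h24 fun p hp => (hK p hp).1⟩
    · -- (1.9) for `g̃`
      obtain ⟨c₇, K₇, h27'⟩ := h27
      exact A.moebiusSq_hyp19 h24 (fun p hp => (hK p hp).2) h27'
    · -- (R) = (9.7): `C A(x)/(log x)^{2^22+1} ≤ (G/2) A(x)/(log x)^{2^22} ≤ Ã(x)/(log x)^{2^22}`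
      filter_upwards [hmain, hlow, hlog.eventually_ge_atTop (1 : ℝ)] with x hx hlx hl1
      intro t ht
      have hl0 : 0 < Real.log x := by linarith
      have h1 := hx.1 t ht
      simp only [← hAt_rem] at h1
      refine h1.trans ?_
      rw [SieveSequence.fiLogSaving, pow_succ, mul_comm (Real.log x ^ (2 ^ 22)) (Real.log x), ← div_div]
      exact div_le_div_of_nonneg_right (hlx.2.2.trans hlx.1) (pow_nonneg hl0.le _)
  -- ### the parameter clause (10.2) = (2.15) and the sieved bilinear bound (B*₂₂) from (2.11)
  have hparams : ∀ᶠ x : ℝ in atTop, 2 ≤ Real.log x ^ α ∧ 2 ≤ x ^ θ ∧ 2 ≤ P x ∧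
      P x ≤ (x ^ θ) ^ (1 / (2 ^ 35 * Real.log (Real.log x))) :=
    hpar.mono fun x hx => ⟨hx.2.2.1, hx.2.2.1.trans hx.2.2.2.1, hx.2.2.2.2.1, hx.2.2.2.2.2⟩
  have hB : ∀ᶠ x : ℝ in atTop, ∀ N : ℝ, Real.sqrt (D x) / x ^ θ < N →
      N < Real.sqrt x / Real.log x ^ α → ∀ C' : ℝ, 1 ≤ C' → C' ≤ x / D x →
        At.fiBilinearRough x N C' (P x) ≤ At.size x / Real.log x ^ SieveSequence.fiLogSaving := by
    filter_upwards [h211, hlow, hlog.eventually_ge_atTop (max (2 / G) 1)] with x hx hlx hlogx N hN1 hN2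
      C' hC1 hC2
    have hl1 : 1 ≤ Real.log x := le_trans (le_max_right _ _) hlogx
    have hl0 : 0 < Real.log x := by linarith
    have hA0 := hA_nonneg x
    have hAt0 := (hAt_le x).1
    have hAG : A.size x ≤ 2 / G * At.size x := by
      rw [div_mul_eq_mul_div, le_div_iff₀ hG0]; linarith [hlx.1]
    -- `(2/G) (log x)^{-2^26} ≤ (log x)^{-2^22}`
    have hpow : 2 / G * Real.log x ^ SieveSequence.fiLogSaving ≤ Real.log x ^ (2 ^ 26 : ℕ) := by
      rw [SieveSequence.fiLogSaving, show (2 ^ 26 : ℕ) = (2 ^ 26 - 2 ^ 22 - 1) + 1 + 2 ^ 22 by norm_num,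
        pow_add, pow_succ]
      refine mul_le_mul_of_nonneg_right ?_ (pow_nonneg hl0.le _)
      calc 2 / G = 1 * (2 / G) := (one_mul _).symm
        _ ≤ Real.log x ^ (2 ^ 26 - 2 ^ 22 - 1) * Real.log x :=
            mul_le_mul (one_le_pow₀ hl1) (le_trans (le_max_left _ _) hlogx) (by positivity)
              (pow_nonneg hl0.le _)
    calc At.fiBilinearRough x N C' (P x) ≤ A.fiBilinearPi x N C' (P x) :=
          A.moebiusSq_fiBilinearRough_le_fiBilinearPi x N C' (P x)
      _ ≤ A.size x / Real.log x ^ (2 ^ 26 : ℕ) := hx C' hC1 hC2 N hN1 hN2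
      _ ≤ (2 / G * At.size x) / (2 / G * Real.log x ^ SieveSequence.fiLogSaving) := by
          refine (div_le_div_of_nonneg_left hA0 (by positivity) hpow).trans ?_
          exact div_le_div_of_nonneg_right hAG (by positivity)
      _ = At.size x / Real.log x ^ SieveSequence.fiLogSaving :=
          mul_div_mul_left _ _ (by positivity)
  -- ### `H̃ = H/G` and Theorem 1 under (B*₂₂) for `ã`
  have hHt : At.HasDensityConstant (H / sqConst A.density) :=
    A.hasDensityConstant_moebiusSq h24 (fun p hp => (hK p hp).2) hH
  have hT := fi_asymptotic_sieve_primes_roughWeak_loglog At D P α θ (H / sqConst A.density) hα hθ hθ3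
    hcore hparams hB hHt
  -- ### (9.14): back to `A`
  rw [← hGeq] at hT
  have hS : ∀ x : ℝ, ∑ p ∈ Nat.primesLE ⌊x⌋₊, At.a p * Real.log p = ∑ p ∈ Nat.primesLE ⌊x⌋₊, A.a p * Real.log p :=
    fun x => A.moebiusSq_primeSum x
  -- the main-term exchange `H̃ Ã(x) - H A(x) = (H/G)(Ã(x) - G A(x))`
  have hexch : (fun x : ℝ => H / G * At.size x - H * A.size x) =O[atTop]
      fun x : ℝ => H * A.size x * (Real.log (Real.log x) / Real.log x) := by
    refine IsBigO.of_bound (|C| / G) ?_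
    filter_upwards [hlow, hlog.eventually_ge_atTop (1 : ℝ),
      (Real.tendsto_log_atTop.comp hlog).eventually_ge_atTop (1 : ℝ)] with x hlx hl1 hll1
    have hl0 : 0 < Real.log x := by linarith
    have hA0 := hA_nonneg x
    have hll1' : 1 ≤ Real.log (Real.log x) := hll1
    have h2 := hlx.2.1
    rw [Real.norm_eq_abs, Real.norm_eq_abs]
    calc |H / G * At.size x - H * A.size x| = |H| / G * |At.size x - G * A.size x| := by
          rw [show H / G * At.size x - H * A.size x = H / G * (At.size x - G * A.size x) by
            rw [mul_sub, ← mul_assoc, div_mul_cancel₀ H hGne], abs_mul, abs_div, abs_of_pos hG0]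
      _ ≤ |H| / G * (C * A.size x / Real.log x) := mul_le_mul_of_nonneg_left h2 (by positivity)
      _ ≤ |H| / G * (|C| * A.size x / Real.log x * Real.log (Real.log x)) := by
          refine mul_le_mul_of_nonneg_left ?_ (by positivity)
          calc C * A.size x / Real.log x ≤ |C| * A.size x / Real.log x :=
                div_le_div_of_nonneg_right (mul_le_mul_of_nonneg_right (le_abs_self C) hA0) hl0.le
            _ = |C| * A.size x / Real.log x * 1 := (mul_one _).symm
            _ ≤ |C| * A.size x / Real.log x * Real.log (Real.log x) :=
                mul_le_mul_of_nonneg_left hll1' (by positivity)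
      _ = |C| / G * |H * A.size x * (Real.log (Real.log x) / Real.log x)| := by
          rw [abs_mul, abs_mul, abs_of_nonneg hA0,
            abs_of_nonneg (div_nonneg (by linarith) hl0.le : (0 : ℝ) ≤ Real.log (Real.log x) / Real.log x)]
          field_simp
  -- the error term of Theorem 1 for `ã` against `H A(x) log log x / log x`
  have hcomp : (fun x : ℝ => H / G * At.size x * (Real.log (Real.log x) / Real.log x)) =O[atTop]
      fun x : ℝ => H * A.size x * (Real.log (Real.log x) / Real.log x) := by
    refine IsBigO.of_bound (1 / G) ?_
    filter_upwards [hlog.eventually_ge_atTop (1 : ℝ),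
      (Real.tendsto_log_atTop.comp hlog).eventually_ge_atTop (0 : ℝ)] with x hl1 hll0
    have hl0 : 0 < Real.log x := by linarith
    have hA0 := hA_nonneg x
    have hll0' : 0 ≤ Real.log (Real.log x) := hll0
    obtain ⟨hAt0, hAtA⟩ := hAt_le x
    rw [Real.norm_eq_abs, Real.norm_eq_abs, abs_mul, abs_mul, abs_mul, abs_mul, abs_div,
      abs_of_pos hG0, abs_of_nonneg hAt0, abs_of_nonneg hA0,
      abs_of_nonneg (div_nonneg hll0' hl0.le)]
    calc |H| / G * At.size x * (Real.log (Real.log x) / Real.log x)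
        ≤ |H| / G * A.size x * (Real.log (Real.log x) / Real.log x) := by
          refine mul_le_mul_of_nonneg_right (mul_le_mul_of_nonneg_left hAtA (by positivity)) ?_
          positivity
      _ = 1 / G * (|H| * A.size x * (Real.log (Real.log x) / Real.log x)) := by ring
  have hsum := (hT.trans hcomp).add hexch
  refine hsum.congr' ?_ EventuallyEq.rfl
  filter_upwards with x
  rw [hS x]
  ring

end Literature.NumberTheory.Sieve
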